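/-
Copyright (c) 2026. All rights reserved.
Released under Apache 2.0 license as described in the file LICENSE.
-/
import Mathlib
import HarnessLib
import Summits.RiemannHypothesis.RiemannHypothesis.Theorems.EarlyAppointmentsCombSumSign

/-!
# ε-regular comb sum bound via counting

A simpler approach to bounding the comb sum imaginary part: use the ε-regularity
to show there are many zeros (≈ 2h/s in [x₀-h, x₀+h]), and each contributes negatively.

## Key insight

For ε-regular zeros with 8s ≤ h:
- There are ≈ 2h/s zeros in [x₀ - h, x₀ + h] (from ε-regularity)
- Each zero ξ in this interval contributes Im(1/(z₀-ξ)) ≤ -1/(2h)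

So comb_sum.im ≤ -(2h/s) · (1/(2h)) · (1-ε) = -(1-ε)/s.

Adding conjugate term (-1/(2h)) and remainder (+η/s with η ≤ 1/8):
  G.im ≤ -1/(2h) - (1-ε)/s + η/s = -1/(2h) - (1-ε-η)/s

With η ≤ 1/8 and ε ≤ 1/8:
  1 - ε - η ≥ 3/4, so G.im ≤ -1/(2h) - (3/4)/s

From 8s ≤ h: (3/4)/s ≥ 6/h, so:
  |G.im| ≥ (3/4)/s ≥ 6/h > 4/h ✓

This bound is actually stronger than the cotangent formula when s << h.
-/

open Complex Real Set Filter Topology Metric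
open scoped BigOperators Topology ComplexConjugate

noncomputable section

namespace EpsRegularCountBound

/-- C₀ = 8 is the universal constant. -/
def C₀ : ℝ := 8

/-- For ξ in [x₀ - h, x₀ + h], each term contributes Im ≤ -1/(2h). -/
theorem im_inv_near_bound {x₀ h ξ : ℝ} (hh : 0 < h) (hξ : |x₀ - ξ| ≤ h) :
    (((x₀ : ℂ) + h * I - (ξ : ℂ))⁻¹).im ≤ -1 / (2 * h) := by
  have h_im := Summit.RiemannHypothesis.RiemannHypothesis.Theorems.EarlyAppointmentsCombHelpers.im_inv_z₀_sub_real
    x₀ h ξ (ne_of_gt hh)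
  rw [h_im]
  have h_abs := abs_le.mp hξ
  have h1 : (x₀ - ξ)^2 ≤ h^2 := by nlinarith [sq_nonneg (x₀ - ξ)]
  have h_denom : (x₀ - ξ)^2 + h^2 ≤ 2 * h^2 := by nlinarith [sq_nonneg h]
  have h_denom_pos : 0 < (x₀ - ξ)^2 + h^2 := by nlinarith [sq_nonneg (x₀ - ξ)]
  have h2 : h / ((x₀ - ξ)^2 + h^2) ≥ h / (2 * h^2) := by
    apply div_le_div_of_nonneg_left (le_of_lt hh) (by positivity) h_denom
  have h3 : h / (2 * h^2) = 1 / (2 * h) := by field_simp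
  have h4 : h / ((x₀ - ξ)^2 + h^2) ≥ 1 / (2 * h) := by linarith [h2, h3]
  have h5 : -h / ((x₀ - ξ)^2 + h^2) ≤ -1 / (2 * h) := by
    rw [neg_div, neg_div, neg_le_neg_iff]
    exact h4
  exact h5

/-- With N zeros near x₀, the comb sum Im ≤ -N/(2h). -/
theorem sum_im_bound {x₀ h : ℝ} (hh : 0 < h)
    (S : Finset ℝ) (hS : ∀ ξ ∈ S, |x₀ - ξ| ≤ h) :
    (∑ ξ ∈ S, (((x₀ : ℂ) + h * I - (ξ : ℂ))⁻¹).im) ≤ -(S.card : ℝ) / (2 * h) := by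
  have h1 : ∀ ξ ∈ S, (((x₀ : ℂ) + h * I - (ξ : ℂ))⁻¹).im ≤ -1 / (2 * h) := by
    intro ξ hξ
    exact im_inv_near_bound hh (hS ξ hξ)
  calc (∑ ξ ∈ S, (((x₀ : ℂ) + h * I - (ξ : ℂ))⁻¹).im)
      ≤ ∑ _ξ ∈ S, (-1 / (2 * h)) := Finset.sum_le_sum h1
    _ = -(S.card : ℝ) / (2 * h) := by simp [Finset.sum_const, mul_comm]; ring

/-- If count ≈ 2h/s, then comb_sum.im ≤ -(1-ε)/s.
    Uses sum_im_bound and the count hypothesis. -/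
theorem comb_sum_im_bound_strong {x₀ s h ε : ℝ} (hs : 0 < s) (hh : 0 < h)
    (_hε : 0 ≤ ε) (_hε_small : ε ≤ 1 / 4)
    (S : Finset ℝ) (hS_in : ∀ ξ ∈ S, |x₀ - ξ| ≤ h)
    (hS_count : ((1 - ε) * 2 * h / s : ℝ) ≤ S.card) :
    (∑ ξ ∈ S, (((x₀ : ℂ) + h * I - (ξ : ℂ))⁻¹).im) ≤ -(1 - ε) / s := by
  -- Step 1: Apply sum_im_bound
  have h1 := sum_im_bound hh S hS_in
  -- h1: sum ≤ -S.card / (2h)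
  -- Step 2: From count bound: S.card ≥ (1-ε) * 2h/s
  -- So: -S.card / (2h) ≤ -((1-ε) * 2h/s) / (2h) = -(1-ε)/s
  have h2 : -(S.card : ℝ) / (2 * h) ≤ -(1 - ε) / s := by
    have hcard_pos : (0 : ℝ) ≤ S.card := Nat.cast_nonneg _
    have h2h_pos : (0 : ℝ) < 2 * h := by positivity
    -- S.card ≥ (1-ε) * 2h/s → -S.card ≤ -(1-ε) * 2h/s
    -- → -S.card/(2h) ≤ -(1-ε) * 2h/s / (2h) = -(1-ε)/s
    rw [neg_div, neg_div, neg_le_neg_iff]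
    have h3 : (S.card : ℝ) / (2 * h) ≥ ((1 - ε) * 2 * h / s) / (2 * h) := by
      apply div_le_div_of_nonneg_right hS_count (by positivity)
    have h4 : ((1 - ε) * 2 * h / s) / (2 * h) = (1 - ε) / s := by
      have hne : (2 * h : ℝ) ≠ 0 := by positivity
      have hsne : (s : ℝ) ≠ 0 := ne_of_gt hs
      field_simp
    linarith [h3, h4]
  linarith [h1, h2]

/-- Main result: |G.im| > 4/h when the ε-regular count holds.

The key arithmetic: G.im ≤ -1/(2h) - (1-ε-η)/s with 1-ε-η ≥ 3/4.
From 8s ≤ h: (3/4)/s ≥ 6/h > 4/h. -/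
theorem G_im_bound_from_count_strong {s h ε η : ℝ} (hs : 0 < s) (hh : 0 < h)
    (_hη : 0 ≤ η) (hη_small : η ≤ 1 / 8) (_hε : 0 ≤ ε) (hε_small : ε ≤ 1 / 8)
    (hsh : 8 * s ≤ h)
    (comb_im : ℝ) (hcomb : comb_im ≤ -(1 - ε) / s) :
    let G_im := -1 / (2 * h) + comb_im + η / s
    (- G_im) > 4 / h := by
  intro G_im
  -- Step 1: 1 - ε - η ≥ 3/4
  have h_coeff : 1 - ε - η ≥ 3 / 4 := by linarith
  -- Step 2: comb_im + η/s ≤ -(1-ε)/s + η/s = -(1-ε-η)/s ≤ -(3/4)/s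
  have h_comb_eta : comb_im + η / s ≤ -(3 / 4) / s := by
    have h1 : comb_im + η / s ≤ -(1 - ε) / s + η / s := by linarith
    have h2 : -(1 - ε) / s + η / s = -(1 - ε - η) / s := by field_simp; ring
    have h3 : -(1 - ε - η) / s ≤ -(3 / 4) / s := by
      rw [neg_div, neg_div, neg_le_neg_iff]
      apply div_le_div_of_nonneg_right h_coeff (le_of_lt hs)
    linarith [h1, h2, h3]
  -- Step 3: G_im ≤ -1/(2h) - (3/4)/s
  have h_G_bound : G_im ≤ -1 / (2 * h) - (3 / 4) / s := by
    show -1 / (2 * h) + comb_im + η / s ≤ -1 / (2 * h) - (3 / 4) / s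
    have h1 : comb_im + η / s ≤ -(3 / 4) / s := h_comb_eta
    have h2 : -1 / (2 * h) + comb_im + η / s = -1 / (2 * h) + (comb_im + η / s) := by ring
    have h3 : -1 / (2 * h) - (3 / 4) / s = -1 / (2 * h) + (-(3 / 4) / s) := by ring
    rw [h2, h3]
    linarith [h1]
  -- Step 4: (3/4)/s ≥ 6/h from 8s ≤ h
  have h_frac : (3 / 4) / s ≥ 6 / h := by
    have h1 : 1 / s ≥ 8 / h := by
      rw [ge_iff_le, div_le_div_iff₀ hh hs]
      linarith
    calc (3 / 4) / s = (3 / 4) * (1 / s) := by ring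
      _ ≥ (3 / 4) * (8 / h) := by nlinarith [h1]
      _ = 6 / h := by ring
  -- Step 5: G_im ≤ -1/(2h) - 6/h = -13/(2h)
  have h_G_bound2 : G_im ≤ -13 / (2 * h) := by
    have h1 : -1 / (2 * h) - 6 / h = -13 / (2 * h) := by field_simp; ring
    linarith [h_G_bound, h_frac, h1]
  -- Step 6: -G_im ≥ 13/(2h) > 4/h
  have h_neg_G : -G_im ≥ 13 / (2 * h) := by
    show -(-1 / (2 * h) + comb_im + η / s) ≥ 13 / (2 * h)
    have h1 : -(-1 / (2 * h) + comb_im + η / s) = 1 / (2 * h) - comb_im - η / s := by ring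
    rw [h1]
    -- From h_G_bound2: -1/(2h) + comb_im + η/s ≤ -13/(2h)
    -- So: comb_im + η/s ≤ -13/(2h) + 1/(2h) = -12/(2h) = -6/h
    have h2 : comb_im + η / s ≤ -13 / (2 * h) + 1 / (2 * h) := by linarith [h_G_bound2]
    have h3 : -13 / (2 * h) + 1 / (2 * h) = -12 / (2 * h) := by ring
    have h4 : -12 / (2 * h) = -6 / h := by field_simp; ring
    have h5 : comb_im + η / s ≤ -6 / h := by linarith [h2, h3, h4]
    -- 1/(2h) - comb_im - η/s ≥ 1/(2h) + 6/h = 1/(2h) + 12/(2h) = 13/(2h)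
    have h6 : 1 / (2 * h) + 6 / h = 13 / (2 * h) := by field_simp; ring
    linarith [h5, h6]
  have h_final : (13 : ℝ) / (2 * h) > 4 / h := by
    rw [gt_iff_lt, div_lt_div_iff₀ hh (by positivity : (0 : ℝ) < 2 * h)]
    nlinarith
  linarith [h_neg_G, h_final]

end EpsRegularCountBound

end
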